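import Literature.Analysis.FunctionSpaces.TorusAnalyticSeminorm
import Literature.Analysis.FunctionSpaces.TorusScalarFourierSeries
import Literature.Analysis.FunctionSpaces.TorusFourierSeries
import Literature.Analysis.FunctionSpaces.TorusAnalyticFourierDecay
import Mathlib.Analysis.Complex.ExponentialBounds
import Mathlib.Analysis.Real.Pi.Bounds
import HarnessLib

/-!
# Exponential decay of Fourier coefficients from all-orders analyticity-seminorm bounds on `T^d`

Analysis/FunctionSpaces support file (everything proved; no definitions, no named facts).  If a smooth
`g : T^d → F` (values in a complete complex normed space) satisfies the Armstrong–Vicol analyticity bounds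
`⟦g⟧_{m,R} ≤ M` for EVERY order `m` (`Torus.dnorm`, App. A (A.1) of arXiv:2305.05048: `‖∂^l g‖_∞ ≤ M m! Rᵐ/(m+1)²`
for all words of length `m`), then its Fourier coefficients decay exponentially at the rate `2π/(eR)` in the
sup norm of the frequency,

  `‖ĝ(k)‖ ≤ e · M · exp(−2π|kⱼ|/(eR))`  for every coordinate `j`

(`norm_mFourierCoeff_le_exp_of_forall_dnorm_le`: Grafakos's `𝓕(∂ⱼᵐ g)(k) = (2πi kⱼ)ᵐ ĝ(k)` at the order
`m = ⌊2π|kⱼ|/(eR)⌋`, `m! ≤ mᵐ`), and consequently the `ℓ¹` TAIL outside the frequency ball of radius `Q` is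
exponentially small,

  `Σ_{k ∉ ball Q} ‖ĝ(k)‖ ≤ e · M · (1 + 2dR)^d · exp(−πQ/(e d R))`

(`tsum_norm_mFourierCoeff_compl_freqBall_le`: `|k|₂ ≤ Σⱼ|kⱼ| ≤ d·maxⱼ|kⱼ|`, half of the decay pays for `Q`,
the other half is summed as a product of one-dimensional geometric series).  This is the real-variable form
of the Paley–Wiener estimate for functions analytic in a strip of width `~1/R` (Grafakos, Classical Fourier
Analysis, Thm. 3.3.9 for the `C^k` version; Katznelson, An Introduction to Harmonic Analysis, Ch. I §4 for
the analytic one), stated over the tree's seminorms so that the flow / composition estimates of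
`TorusAnalyticComposition` (Armstrong–Vicol App. A Props. 7.6, 7.11) feed it directly.

Consumer: cell `ad-ideate`, K1L_D `stmt-AnomalousDissipation-27980`, W3-E (ii) `stub_effectiveFrameEnergyL_bandKill`
(the spectral tail of the pushed-forward Lagrangian levels, finding F-k3l-7).

## Mathlib / tree search
Tree: `Torus.norm_mFourierCoeff_le_of_partialDeriv_iterate`, `Torus.norm_iterPartialDeriv_le_of_dnorm_le`,
`Torus.summable_norm_mFourierCoeff_scalar`, `Torus.exists_subset_piFinset`, `Torus.not_mem_freqBall`.
Mathlib: `Nat.factorial_le_pow`, `Nat.floor_le`, `Nat.lt_floor_add_one`, `Finset.sum_prod_piFinset`,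
`tsum_of_nat_of_neg_add_one`, `tsum_geometric_of_lt_one`, `Real.add_one_le_exp`.

## References
* L. Grafakos, *Classical Fourier Analysis*, 3rd ed., GTM 249 (2014), Thm. 3.3.9. [`Grafakos2014`]
* S. Armstrong, V. Vicol, Ann. PDE 11 (2025), arXiv:2305.05048, App. A (A.1). [`ArmstrongVicol2025`]
-/

noncomputable section

open MeasureTheory Set Filter UnitAddTorus Finset
open scoped ContDiff

namespace Literature.Analysis.FunctionSpaces

namespace Torus

variable {d : Type*} [Fintype d] [DecidableEq d]
variable {F : Type*} [NormedAddCommGroup F] [NormedSpace ℂ F] [CompleteSpace F]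

/-! ## The coefficient bound at one order -/

omit [Fintype d] [CompleteSpace F] in
/-- `(∂ⱼ)^[m] g = ∂^{[j,…,j]} g` (the word with `m` letters `j`). [folklore] -/
private theorem partialDeriv_iterate_eq_iterPartialDeriv_replicate (j : d) (m : ℕ) (g : UnitAddTorus d → F) :
    (partialDeriv j)^[m] g = iterPartialDeriv (List.replicate m j) g := by
  induction m with
  | zero => rfl
  | succ m ih =>
    rw [Function.iterate_succ', Function.comp_apply, ih, List.replicate_succ, iterPartialDeriv_cons]

/-- **Order-`m` coefficient bound from the seminorm**: `⟦g⟧_{m,R} ≤ M` gives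
`‖ĝ(k)‖ ≤ (M m! Rᵐ/(m+1)²)/(2π|kⱼ|)ᵐ` for `kⱼ ≠ 0`. [cite: Grafakos2014, Thm. 3.3.9] -/
theorem norm_mFourierCoeff_le_of_dnorm_le_scalar {g : UnitAddTorus d → F} (hg : IsSmooth g) {R M : ℝ} (hR : 0 < R)
    {m : ℕ} (hM : dnorm m R g ≤ M) (k : d → ℤ) {j : d} (hk : k j ≠ 0) :
    ‖mFourierCoeff g k‖ ≤
      (M * ((Nat.factorial m : ℝ) * R ^ m) / ((m : ℝ) + 1) ^ 2) / (2 * Real.pi * |(k j : ℝ)|) ^ m := by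
  have hD : ∀ x, ‖((partialDeriv j)^[m] g) x‖ ≤ M * ((Nat.factorial m : ℝ) * R ^ m) / ((m : ℝ) + 1) ^ 2 := by
    intro x
    rw [partialDeriv_iterate_eq_iterPartialDeriv_replicate]
    exact norm_iterPartialDeriv_le_of_dnorm_le hg hR hM (by simp) x
  exact norm_mFourierCoeff_le_of_partialDeriv_iterate hg j m hk hD

/-- The order-zero bound: `‖ĝ(k)‖ ≤ ⟦g⟧_{0,R} = ‖g‖_∞`. [cite: Grafakos2014, Thm. 3.3.9] -/
theorem norm_mFourierCoeff_le_of_dnorm_zero_le {g : UnitAddTorus d → F} (hg : IsSmooth g) {R M : ℝ} (hR : 0 < R)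
    (hM : dnorm 0 R g ≤ M) (k : d → ℤ) : ‖mFourierCoeff g k‖ ≤ M := by
  have hD : ∀ x, ‖g x‖ ≤ M := by
    intro x
    have h := norm_iterPartialDeriv_le_of_dnorm_le hg hR hM (l := []) rfl x
    simpa using h
  exact norm_mFourierCoeff_le_of_forall_norm_le hD k

/-! ## Exponential decay from all orders -/

/-- The elementary optimisation: for `x > 0` and `m = ⌊x/e⌋`, `m! x^{-m} ≤ e · exp(−x/e)`
(`m! ≤ mᵐ`, `m/x ≤ 1/e`, `x/e < m + 1`). [folklore] -/
private theorem factorial_div_pow_le_exp {x : ℝ} (hx : 0 < x) :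
    (Nat.factorial ⌊x / Real.exp 1⌋₊ : ℝ) / x ^ ⌊x / Real.exp 1⌋₊ ≤
      Real.exp 1 * Real.exp (-(x / Real.exp 1)) := by
  set m : ℕ := ⌊x / Real.exp 1⌋₊ with hm
  have he : 0 < Real.exp 1 := Real.exp_pos 1
  have hxe : 0 ≤ x / Real.exp 1 := div_nonneg hx.le he.le
  have hm_le : (m : ℝ) ≤ x / Real.exp 1 := Nat.floor_le hxe
  have hm_lt : x / Real.exp 1 < (m : ℝ) + 1 := Nat.lt_floor_add_one _
  -- `m! ≤ m^m`
  have hfac : (Nat.factorial m : ℝ) ≤ (m : ℝ) ^ m := by exact_mod_cast Nat.factorial_le_pow m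
  -- `(m/x)^m ≤ (1/e)^m = exp(-m)`
  have hratio : (m : ℝ) / x ≤ (Real.exp 1)⁻¹ := by
    rw [div_le_iff₀ hx]
    calc (m : ℝ) ≤ x / Real.exp 1 := hm_le
      _ = (Real.exp 1)⁻¹ * x := by rw [div_eq_inv_mul]
  have hpow : ((m : ℝ) / x) ^ m ≤ (Real.exp 1)⁻¹ ^ m :=
    pow_le_pow_left₀ (div_nonneg (Nat.cast_nonneg _) hx.le) hratio m
  have hexpm : (Real.exp 1)⁻¹ ^ m = Real.exp (-(m : ℝ)) := by
    rw [← Real.exp_neg, ← Real.exp_nat_mul]; ring_nf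
  calc (Nat.factorial m : ℝ) / x ^ m ≤ (m : ℝ) ^ m / x ^ m :=
        div_le_div_of_nonneg_right hfac (pow_nonneg hx.le _)
    _ = ((m : ℝ) / x) ^ m := by rw [div_pow]
    _ ≤ Real.exp (-(m : ℝ)) := hpow.trans_eq hexpm
    _ ≤ Real.exp 1 * Real.exp (-(x / Real.exp 1)) := by
        rw [← Real.exp_add]
        exact Real.exp_le_exp.2 (by linarith)

/-- **Exponential decay of the coefficients**: if `⟦g⟧_{m,R} ≤ M` for every order `m`, then for every
frequency `k` and every coordinate `j`, `‖ĝ(k)‖ ≤ e · M · exp(−2π|kⱼ|/(eR))`.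
[cite: Grafakos2014, Thm. 3.3.9] -/
theorem norm_mFourierCoeff_le_exp_of_forall_dnorm_le {g : UnitAddTorus d → F} (hg : IsSmooth g) {R M : ℝ}
    (hR : 0 < R) (hM : ∀ m, dnorm m R g ≤ M) (k : d → ℤ) (j : d) :
    ‖mFourierCoeff g k‖ ≤ Real.exp 1 * M * Real.exp (-(2 * Real.pi * |(k j : ℝ)| / (Real.exp 1 * R))) := by
  have hM0 : 0 ≤ M := (dnorm_nonneg 0 hR.le g).trans (hM 0)
  have he1 : 1 ≤ Real.exp 1 := Real.one_le_exp (by norm_num)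
  by_cases hk : k j = 0
  · -- the order-zero bound
    have h0 := norm_mFourierCoeff_le_of_dnorm_zero_le hg hR (hM 0) k
    have : (k j : ℝ) = 0 := by exact_mod_cast hk
    rw [this, abs_zero, mul_zero, zero_div, neg_zero, Real.exp_zero, mul_one]
    exact h0.trans (le_mul_of_one_le_left hM0 he1)
  · set x : ℝ := 2 * Real.pi * |(k j : ℝ)| / R with hx
    have hkpos : 0 < |(k j : ℝ)| := abs_pos.2 (by exact_mod_cast hk)
    have hxpos : 0 < x := by rw [hx]; positivity
    set m : ℕ := ⌊x / Real.exp 1⌋₊ with hm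
    have h1 := norm_mFourierCoeff_le_of_dnorm_le_scalar hg hR (hM m) k hk
    -- rewrite the order-`m` bound as `M (m!/x^m)/(m+1)²`
    have hden : (2 * Real.pi * |(k j : ℝ)|) ^ m = x ^ m * R ^ m := by
      rw [← mul_pow, hx, div_mul_cancel₀ _ hR.ne']
    have hRm : 0 < R ^ m := pow_pos hR m
    have hm1 : 1 ≤ ((m : ℝ) + 1) ^ 2 := by nlinarith [(Nat.cast_nonneg m : (0 : ℝ) ≤ m)]
    have key : (M * ((Nat.factorial m : ℝ) * R ^ m) / ((m : ℝ) + 1) ^ 2) / (2 * Real.pi * |(k j : ℝ)|) ^ m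
        ≤ M * ((Nat.factorial m : ℝ) / x ^ m) := by
      rw [hden]
      rw [div_div, div_le_iff₀ (by positivity)]
      calc M * ((Nat.factorial m : ℝ) * R ^ m)
          = M * ((Nat.factorial m : ℝ) / x ^ m) * (1 * (x ^ m * R ^ m)) := by
            field_simp
        _ ≤ M * ((Nat.factorial m : ℝ) / x ^ m) * (((m : ℝ) + 1) ^ 2 * (x ^ m * R ^ m)) := by
            refine mul_le_mul_of_nonneg_left (mul_le_mul_of_nonneg_right hm1 (by positivity)) ?_
            exact mul_nonneg hM0 (div_nonneg (Nat.cast_nonneg _) (pow_nonneg hxpos.le _))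
    have h2 := factorial_div_pow_le_exp hxpos
    have hxe : x / Real.exp 1 = 2 * Real.pi * |(k j : ℝ)| / (Real.exp 1 * R) := by
      rw [hx, div_div, mul_comm R]
    calc ‖mFourierCoeff g k‖ ≤ M * ((Nat.factorial m : ℝ) / x ^ m) := h1.trans key
      _ ≤ M * (Real.exp 1 * Real.exp (-(x / Real.exp 1))) := mul_le_mul_of_nonneg_left h2 hM0
      _ = Real.exp 1 * M * Real.exp (-(2 * Real.pi * |(k j : ℝ)| / (Real.exp 1 * R))) := by rw [hxe]; ring

/-! ## The `ℓ¹` tail outside a frequency ball -/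

omit [DecidableEq d] in
/-- One-dimensional geometric series over `ℤ`: `Σ_{n ∈ T} e^{−a|n|} ≤ 1 + 2/a` for every finite `T ⊆ ℤ`
and `a > 0` (`Σ_{n∈ℤ} r^{|n|} = (1+r)/(1−r) = 1 + 2/(eᵃ − 1)`, `eᵃ − 1 ≥ a`). [folklore] -/
private theorem sum_exp_neg_mul_abs_le {a : ℝ} (ha : 0 < a) (T : Finset ℤ) :
    ∑ n ∈ T, Real.exp (-(a * |(n : ℝ)|)) ≤ 1 + 2 / a := by
  set r : ℝ := Real.exp (-a) with hr
  have hr0 : 0 ≤ r := (Real.exp_pos _).le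
  have hr1 : r < 1 := Real.exp_lt_one_iff.2 (by linarith)
  set f : ℤ → ℝ := fun n => r ^ n.natAbs with hf
  have hterm : ∀ n : ℤ, Real.exp (-(a * |(n : ℝ)|)) = f n := by
    intro n
    show Real.exp (-(a * |(n : ℝ)|)) = Real.exp (-a) ^ n.natAbs
    rw [← Real.exp_nat_mul, Nat.cast_natAbs, Int.cast_abs]
    ring_nf
  have h1 : HasSum (fun n : ℕ => f n) (1 - r)⁻¹ := by
    have h := hasSum_geometric_of_lt_one hr0 hr1
    refine h.congr_fun fun n => ?_
    rw [hf]
    simp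
  have h2 : HasSum (fun n : ℕ => f (-(n + 1 : ℤ))) (r * (1 - r)⁻¹) := by
    have h := (hasSum_geometric_of_lt_one hr0 hr1).mul_left r
    refine h.congr_fun fun n => ?_
    simp only [hf]
    rw [show (-((n : ℤ) + 1)).natAbs = n + 1 by omega, pow_succ']
  have hZ : HasSum f ((1 - r)⁻¹ + r * (1 - r)⁻¹) := h1.of_nat_of_neg_add_one h2
  rw [Finset.sum_congr rfl fun n _ => hterm n]
  refine (sum_le_hasSum T (fun n _ => pow_nonneg hr0 _) hZ).trans ?_
  -- `(1+r)/(1-r) ≤ 1 + 2/a`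
  have h1r : 0 < 1 - r := by linarith
  have hea : a ≤ Real.exp a - 1 := by linarith [Real.add_one_le_exp a]
  have hra : r * (Real.exp a - 1) = 1 - r := by
    rw [hr, mul_sub, ← Real.exp_add, neg_add_cancel, Real.exp_zero, mul_one]
  have key : r * (1 - r)⁻¹ ≤ 1 / a := by
    rw [← div_eq_mul_inv, div_le_div_iff₀ h1r ha]
    calc r * a ≤ r * (Real.exp a - 1) := mul_le_mul_of_nonneg_left hea hr0
      _ = 1 * (1 - r) := by rw [hra, one_mul]
  have hinv : (1 - r)⁻¹ + r * (1 - r)⁻¹ = 1 + 2 * (r * (1 - r)⁻¹) := by field_simp; ring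
  rw [hinv]
  have : 2 / a = 2 * (1 / a) := by ring
  linarith

omit [DecidableEq d] in
/-- Lattice sums of the product weight: for every finite `u ⊆ ℤ^d` and `a > 0`,
`Σ_{k ∈ u} Πᵢ e^{−a|kᵢ|} ≤ (1 + 2/a)^d`. [folklore] -/
private theorem sum_prod_exp_neg_mul_abs_le {a : ℝ} (ha : 0 < a) (u : Finset (d → ℤ)) :
    ∑ k ∈ u, ∏ i, Real.exp (-(a * |(k i : ℝ)|)) ≤ (1 + 2 / a) ^ Fintype.card d := by
  classical
  obtain ⟨T, hsub⟩ := exists_subset_piFinset u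
  have hnn : ∀ k : d → ℤ, 0 ≤ ∏ i, Real.exp (-(a * |(k i : ℝ)|)) := fun k =>
    Finset.prod_nonneg fun i _ => (Real.exp_pos _).le
  calc ∑ k ∈ u, ∏ i, Real.exp (-(a * |(k i : ℝ)|))
      ≤ ∑ k ∈ Fintype.piFinset (fun _ : d => T), ∏ i, Real.exp (-(a * |(k i : ℝ)|)) :=
        Finset.sum_le_sum_of_subset_of_nonneg hsub fun k _ _ => hnn k
    _ = ∏ _i : d, ∑ n ∈ T, Real.exp (-(a * |(n : ℝ)|)) :=
        Finset.sum_prod_piFinset T fun (_ : d) (n : ℤ) => Real.exp (-(a * |(n : ℝ)|))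
    _ ≤ ∏ _i : d, (1 + 2 / a) :=
        Finset.prod_le_prod (fun i _ => Finset.sum_nonneg fun n _ => (Real.exp_pos _).le)
          fun i _ => sum_exp_neg_mul_abs_le ha T
    _ = (1 + 2 / a) ^ Fintype.card d := by rw [Finset.prod_const, Finset.card_univ]

/-- Outside the frequency ball of radius `Q` the `ℓ¹` norm of the frequency exceeds `Q`:
`k ∉ ball Q ⇒ Q < Σᵢ |kᵢ|` (`|k|₂² ≤ (Σᵢ|kᵢ|)²`). [folklore] -/
private theorem lt_sum_abs_of_not_mem_freqBall {Q : ℕ} {k : d → ℤ} (hk : k ∉ freqBall (d := d) Q) :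
    (Q : ℝ) < ∑ i, |(k i : ℝ)| := by
  rw [not_mem_freqBall] at hk
  have hsq : freqNormSq k ≤ (∑ i, |(k i : ℝ)|) ^ 2 := by
    unfold freqNormSq
    calc ∑ i, ((k i : ℝ)) ^ 2 = ∑ i, |(k i : ℝ)| ^ 2 := by simp_rw [sq_abs]
      _ ≤ (∑ i, |(k i : ℝ)|) ^ 2 :=
          Finset.sum_sq_le_sq_sum_of_nonneg fun i _ => abs_nonneg _
  have h := hk.trans_le hsq
  exact lt_of_pow_lt_pow_left₀ 2 (Finset.sum_nonneg fun i _ => abs_nonneg _) h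

omit [DecidableEq d] in
/-- From the coordinatewise decay to the `ℓ¹`-frequency decay: if `‖ĝ(k)‖ ≤ A e^{−c|kⱼ|}` for every `j`,
then `‖ĝ(k)‖ ≤ A e^{−(c/d)Σⱼ|kⱼ|}` (the largest coordinate carries at least the average). [folklore] -/
private theorem norm_le_exp_sum_of_forall_coord {A c : ℝ} (hA : 0 ≤ A) (hc : 0 ≤ c) {v : ℝ} {k : d → ℤ}
    (h : ∀ j, v ≤ A * Real.exp (-(c * |(k j : ℝ)|))) (hv : v ≤ A) :
    v ≤ A * Real.exp (-(c / Fintype.card d * ∑ i, |(k i : ℝ)|)) := by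
  rcases isEmpty_or_nonempty d with hd | hd
  · have : (Finset.univ : Finset d) = ∅ := Finset.univ_eq_empty
    simp [hv]
  · obtain ⟨j, -, hj⟩ := Finset.exists_max_image Finset.univ (fun i => |(k i : ℝ)|) Finset.univ_nonempty
    refine (h j).trans (mul_le_mul_of_nonneg_left (Real.exp_le_exp.2 ?_) hA)
    have hcard : (0 : ℝ) < Fintype.card d := by exact_mod_cast Fintype.card_pos
    have hsum : ∑ i, |(k i : ℝ)| ≤ Fintype.card d * |(k j : ℝ)| := by
      calc ∑ i, |(k i : ℝ)| ≤ ∑ _i : d, |(k j : ℝ)| := Finset.sum_le_sum fun i _ => hj i (Finset.mem_univ i)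
        _ = Fintype.card d * |(k j : ℝ)| := by rw [Finset.sum_const, Finset.card_univ, nsmul_eq_mul]
    have : c / Fintype.card d * ∑ i, |(k i : ℝ)| ≤ c * |(k j : ℝ)| := by
      rw [div_mul_eq_mul_div, div_le_iff₀ hcard]
      calc c * ∑ i, |(k i : ℝ)| ≤ c * (Fintype.card d * |(k j : ℝ)|) := mul_le_mul_of_nonneg_left hsum hc
        _ = c * |(k j : ℝ)| * Fintype.card d := by ring
    linarith

/-- **Abstract lattice tail**: a nonnegative summable `v` on `ℤ^d` with `v k ≤ A` and the coordinatewise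
decay `v k ≤ A e^{−c|kⱼ|}` for every `j` (`c > 0`) has, outside the frequency ball of radius `Q`,
`Σ_{k ∉ ball Q} v k ≤ A · (1 + 4d/c)^d · exp(−cQ/(2d))`. [folklore] -/
private theorem tsum_compl_freqBall_le_of_coord_decay {v : (d → ℤ) → ℝ} {A c : ℝ} (hA : 0 ≤ A) (hc : 0 < c)
    (hcoord : ∀ (k : d → ℤ) (j : d), v k ≤ A * Real.exp (-(c * |(k j : ℝ)|))) (hsup : ∀ k, v k ≤ A) (Q : ℕ)
    (hsum : Summable fun k : {k // k ∉ freqBall (d := d) Q} => v (k : d → ℤ)) :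
    ∑' k : {k // k ∉ freqBall (d := d) Q}, v (k : d → ℤ) ≤
      A * (1 + 4 * Fintype.card d / c) ^ Fintype.card d * Real.exp (-(c * Q / (2 * Fintype.card d))) := by
  classical
  set dd : ℝ := (Fintype.card d : ℝ) with hdd
  have hl1 : ∀ k : d → ℤ, v k ≤ A * Real.exp (-(c / dd * ∑ i, |(k i : ℝ)|)) := fun k =>
    norm_le_exp_sum_of_forall_coord hA hc.le (hcoord k) (hsup k)
  -- the empty-dimension case: every frequency is in the ball
  rcases isEmpty_or_nonempty d with hd | hd
  · have hem : IsEmpty {k // k ∉ freqBall (d := d) Q} := by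
      refine ⟨fun ⟨k, hk⟩ => hk ?_⟩
      rw [mem_freqBall]
      unfold freqNormSq
      rw [Finset.univ_eq_empty, Finset.sum_empty]
      positivity
    rw [tsum_empty]
    have : dd = 0 := by rw [hdd]; exact_mod_cast Fintype.card_eq_zero
    rw [this]
    have hcard : Fintype.card d = 0 := Fintype.card_eq_zero
    simp only [hcard, pow_zero, mul_zero, zero_div, div_zero, neg_zero, Real.exp_zero, mul_one]
    exact hA
  have hdd0 : 0 < dd := by rw [hdd]; exact_mod_cast Fintype.card_pos
  -- outside the ball: split the decay into the `Q`-part and a summable product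
  set a : ℝ := c / (2 * dd) with ha
  have ha0 : 0 < a := by rw [ha]; positivity
  have hout : ∀ k : {k // k ∉ freqBall (d := d) Q},
      v (k : d → ℤ) ≤ A * Real.exp (-(a * Q)) * ∏ i, Real.exp (-(a * |((k : d → ℤ) i : ℝ)|)) := by
    rintro ⟨k, hk⟩
    have hQ := lt_sum_abs_of_not_mem_freqBall hk
    refine (hl1 k).trans ?_
    have hexp : Real.exp (-(c / dd * ∑ i, |(k i : ℝ)|)) ≤
        Real.exp (-(a * Q)) * ∏ i, Real.exp (-(a * |(k i : ℝ)|)) := by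
      rw [← Real.exp_sum, ← Real.exp_add]
      refine Real.exp_le_exp.2 ?_
      have e1 : ∑ i, -(a * |(k i : ℝ)|) = -(a * ∑ i, |(k i : ℝ)|) := by
        rw [Finset.mul_sum, ← Finset.sum_neg_distrib]
      rw [e1]
      have e2 : c / dd * ∑ i, |(k i : ℝ)| = a * ∑ i, |(k i : ℝ)| + a * ∑ i, |(k i : ℝ)| := by
        rw [ha]; field_simp; ring
      rw [e2]
      nlinarith [hQ, ha0]
    calc A * Real.exp (-(c / dd * ∑ i, |(k i : ℝ)|))
        ≤ A * (Real.exp (-(a * Q)) * ∏ i, Real.exp (-(a * |(k i : ℝ)|))) := mul_le_mul_of_nonneg_left hexp hA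
      _ = A * Real.exp (-(a * Q)) * ∏ i, Real.exp (-(a * |(k i : ℝ)|)) := by ring
  -- bound every finite partial sum
  have hbound : ∀ s : Finset {k // k ∉ freqBall (d := d) Q},
      ∑ k ∈ s, v (k : d → ℤ) ≤ A * Real.exp (-(a * Q)) * (1 + 2 / a) ^ Fintype.card d := by
    intro s
    calc ∑ k ∈ s, v (k : d → ℤ)
        ≤ ∑ k ∈ s, A * Real.exp (-(a * Q)) * ∏ i, Real.exp (-(a * |((k : d → ℤ) i : ℝ)|)) :=
          Finset.sum_le_sum fun k _ => hout k
      _ = A * Real.exp (-(a * Q)) * ∑ k ∈ s.map (Function.Embedding.subtype _),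
            ∏ i, Real.exp (-(a * |(k i : ℝ)|)) := by
          rw [Finset.mul_sum, Finset.sum_map]
          rfl
      _ ≤ A * Real.exp (-(a * Q)) * (1 + 2 / a) ^ Fintype.card d :=
          mul_le_mul_of_nonneg_left (sum_prod_exp_neg_mul_abs_le ha0 _) (by positivity)
  refine (hsum.tsum_le_of_sum_le hbound).trans (le_of_eq ?_)
  have e1 : 2 / a = 4 * dd / c := by rw [ha]; field_simp; ring
  have e2 : a * Q = c * Q / (2 * dd) := by rw [ha]; field_simp
  rw [e1, e2]; ring

/-- **THE EXPONENTIALLY SMALL SPECTRAL TAIL.** If `⟦g⟧_{m,R} ≤ M` for every order `m` (`R > 0`), then for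
every `Q : ℕ`

  `Σ_{k ∉ ball Q} ‖ĝ(k)‖ ≤ e · M · (1 + 2dR)^d · exp(−πQ/(e d R))`

(`d = #d`; the ball is `Torus.freqBall Q = {|k|₂ ≤ Q}`).  [cite: Grafakos2014, Thm. 3.3.9] -/
theorem tsum_norm_mFourierCoeff_compl_freqBall_le {g : UnitAddTorus d → F} (hg : IsSmooth g) {R M : ℝ}
    (hR : 0 < R) (hM : ∀ m, dnorm m R g ≤ M) (Q : ℕ) :
    ∑' k : {k // k ∉ freqBall (d := d) Q}, ‖mFourierCoeff g k‖ ≤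
      Real.exp 1 * M * (1 + 2 * Fintype.card d * R) ^ Fintype.card d *
        Real.exp (-(Real.pi * Q / (Real.exp 1 * Fintype.card d * R))) := by
  set dd : ℝ := (Fintype.card d : ℝ) with hdd
  have hM0 : 0 ≤ M := (dnorm_nonneg 0 hR.le g).trans (hM 0)
  have he : 0 < Real.exp 1 := Real.exp_pos 1
  set A : ℝ := Real.exp 1 * M with hA
  have hA0 : 0 ≤ A := mul_nonneg he.le hM0
  set c : ℝ := 2 * Real.pi / (Real.exp 1 * R) with hc
  have hc0 : 0 < c := by rw [hc]; positivity
  have hcoord : ∀ (k : d → ℤ) (j : d), ‖mFourierCoeff g k‖ ≤ A * Real.exp (-(c * |(k j : ℝ)|)) := by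
    intro k j
    have h := norm_mFourierCoeff_le_exp_of_forall_dnorm_le hg hR hM k j
    rw [hA, hc]
    convert h using 3
    ring
  have hsup : ∀ k : d → ℤ, ‖mFourierCoeff g k‖ ≤ A := fun k =>
    (norm_mFourierCoeff_le_of_dnorm_zero_le hg hR (hM 0) k).trans
      (le_mul_of_one_le_left hM0 (Real.one_le_exp (by norm_num)))
  have hsum : Summable fun k : {k // k ∉ freqBall (d := d) Q} => ‖mFourierCoeff g (k : d → ℤ)‖ :=
    (summable_norm_mFourierCoeff_scalar hg).subtype _
  refine (tsum_compl_freqBall_le_of_coord_decay hA0 hc0 hcoord hsup Q hsum).trans ?_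
  -- constants: `1 + 4d/c ≤ 1 + 2 d R` (`e ≤ π`) and `cQ/(2d) = πQ/(e d R)`
  have hepi : Real.exp 1 / Real.pi ≤ 1 := by
    rw [div_le_one Real.pi_pos]
    have := Real.exp_one_lt_d9; have := Real.pi_gt_three; linarith
  have h4 : 4 * dd / c ≤ 2 * dd * R := by
    have e : 4 * dd / c = 2 * dd * R * (Real.exp 1 / Real.pi) := by rw [hc]; field_simp; ring
    rw [e]
    have : 0 ≤ 2 * dd * R := by positivity
    nlinarith
  have hpow : (1 + 4 * dd / c) ^ Fintype.card d ≤ (1 + 2 * dd * R) ^ Fintype.card d :=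
    pow_le_pow_left₀ (by positivity) (by linarith) _
  have hQe : c * Q / (2 * dd) = Real.pi * Q / (Real.exp 1 * dd * R) := by rw [hc]; field_simp
  rw [hQe, hA]
  exact mul_le_mul_of_nonneg_right (mul_le_mul_of_nonneg_left hpow (by positivity)) (Real.exp_pos _).le

/-! ## Real vector fields: componentwise seminorms and the complexified coefficients -/

section Clm

variable {F' G' : Type*} [NormedAddCommGroup F'] [NormedSpace ℝ F'] [NormedAddCommGroup G'] [NormedSpace ℝ G']

/-- Iterated partials commute with continuous linear maps: `∂^l (L ∘ f) = L ∘ ∂^l f` for smooth `f`. [folklore] -/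
private theorem iterPartialDeriv_clm_comp {f : UnitAddTorus d → F'} (hf : IsSmooth f) (L : F' →L[ℝ] G') :
    ∀ l : List d, iterPartialDeriv l (L ∘ f) = L ∘ iterPartialDeriv l f
  | [] => rfl
  | i :: l => by
    rw [iterPartialDeriv_cons, iterPartialDeriv_cons, iterPartialDeriv_clm_comp hf L l]
    funext x
    exact partialDeriv_clm_comp (hf.iterPartialDeriv l) L i x

/-- `derivSup n (L ∘ f) ≤ ‖L‖ · derivSup n f` for smooth `f`. [cite: ArmstrongVicol2025, App. A (A.1)] -/
theorem derivSup_clm_comp_le {f : UnitAddTorus d → F'} (hf : IsSmooth f) (L : F' →L[ℝ] G') (n : ℕ) :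
    derivSup n (L ∘ f) ≤ ‖L‖ * derivSup n f := by
  refine derivSup_le (mul_nonneg (norm_nonneg _) (derivSup_nonneg _ _)) fun l hl y => ?_
  rw [iterPartialDeriv_clm_comp hf L l, Function.comp_apply]
  exact (L.le_opNorm _).trans (mul_le_mul_of_nonneg_left (hl ▸ norm_iterPartialDeriv_le_derivSup hf l y) (norm_nonneg _))

/-- `⟦L ∘ f⟧_{n,R} ≤ ‖L‖ · ⟦f⟧_{n,R}` for smooth `f` and `R ≥ 0`. [cite: ArmstrongVicol2025, App. A (A.1)] -/
theorem dnorm_clm_comp_le {f : UnitAddTorus d → F'} (hf : IsSmooth f) (L : F' →L[ℝ] G') (n : ℕ) {R : ℝ}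
    (hR : 0 ≤ R) : dnorm n R (L ∘ f) ≤ ‖L‖ * dnorm n R f := by
  rw [dnorm_def, dnorm_def, mul_left_comm]
  exact mul_le_mul_of_nonneg_left (derivSup_clm_comp_le hf L n)
    (div_nonneg (sq_nonneg _) (mul_nonneg (Nat.cast_nonneg _) (pow_nonneg hR _)))

end Clm

/-- The real-to-complex coercion does not increase the seminorms: `⟦(fᵢ : ℂ)⟧_{n,R} ≤ ⟦fᵢ⟧_{n,R}`.
[cite: ArmstrongVicol2025, App. A (A.1)] -/
theorem dnorm_ofReal_comp_le {f : UnitAddTorus d → ℝ} (hf : IsSmooth f) (n : ℕ) {R : ℝ} (hR : 0 ≤ R) :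
    dnorm n R (fun x => (f x : ℂ)) ≤ dnorm n R f := by
  have hD : derivSup n (fun x => (f x : ℂ)) ≤ derivSup n f := by
    refine derivSup_le (derivSup_nonneg _ _) fun l hl y => ?_
    have e : (fun x => (f x : ℂ)) = Complex.ofRealCLM ∘ f := rfl
    rw [e, iterPartialDeriv_clm_comp hf Complex.ofRealCLM l, Function.comp_apply, Complex.ofRealCLM_apply,
      Complex.norm_real]
    exact hl ▸ norm_iterPartialDeriv_le_derivSup hf l y
  rw [dnorm_def, dnorm_def]
  exact mul_le_mul_of_nonneg_left hD (div_nonneg (sq_nonneg _) (mul_nonneg (Nat.cast_nonneg _) (pow_nonneg hR _)))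

omit [DecidableEq d] in
/-- `‖z‖ ≤ Σᵢ ‖zᵢ‖` in `ℂ^ι`. [folklore] -/
private theorem norm_le_sum_norm_apply {ι : Type*} [Fintype ι] (z : EuclideanSpace ℂ ι) : ‖z‖ ≤ ∑ i, ‖z i‖ := by
  have h0 : 0 ≤ ∑ i, ‖z i‖ := Finset.sum_nonneg fun i _ => norm_nonneg _
  rw [EuclideanSpace.norm_eq]
  calc Real.sqrt (∑ i, ‖z i‖ ^ 2) ≤ Real.sqrt ((∑ i, ‖z i‖) ^ 2) := by
        refine Real.sqrt_le_sqrt ?_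
        rw [sq, Finset.sum_mul]
        refine Finset.sum_le_sum fun i _ => ?_
        rw [sq]
        exact mul_le_mul_of_nonneg_left (Finset.single_le_sum (fun j _ => norm_nonneg (z j)) (Finset.mem_univ i))
          (norm_nonneg _)
    _ = ∑ i, ‖z i‖ := Real.sqrt_sq h0

/-- **The spectral tail of a real vector field on `T^d` with all-orders seminorm bounds**: if
`⟦u⟧_{m,R} ≤ M` for every `m` (`u : T^d → ℝ^d` smooth, `R > 0`), then

  `Σ_{k ∉ ball Q} ‖𝓕(complexify ∘ u)(k)‖ ≤ d · e · M · (1 + 2dR)^d · exp(−πQ/(e d R))`.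

[cite: Grafakos2014, Thm. 3.3.9] -/
theorem tsum_norm_mFourierCoeff_complexify_compl_freqBall_le {u : UnitAddTorus d → EuclideanSpace ℝ d}
    (hu : IsSmooth u) {R M : ℝ} (hR : 0 < R) (hM : ∀ m, dnorm m R u ≤ M) (Q : ℕ) :
    ∑' k : {k // k ∉ freqBall (d := d) Q}, ‖mFourierCoeff (EuclideanSpace.complexify ∘ u) k‖ ≤
      Fintype.card d * (Real.exp 1 * M * (1 + 2 * Fintype.card d * R) ^ Fintype.card d *
        Real.exp (-(Real.pi * Q / (Real.exp 1 * Fintype.card d * R)))) := by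
  classical
  -- the complex components and their seminorm bounds
  set uc : d → UnitAddTorus d → ℂ := fun i x => ((u x i : ℝ) : ℂ) with huc
  have hui : ∀ i, IsSmooth (fun x => u x i) := fun i => hu.apply i
  have huci : ∀ i, IsSmooth (uc i) := fun i => (hui i).comp_clm Complex.ofRealCLM
  have hMi : ∀ i m, dnorm m R (uc i) ≤ M := fun i m =>
    ((dnorm_ofReal_comp_le (hui i) m hR.le).trans (dnorm_apply_le m hR.le hu i)).trans (hM m)
  -- componentwise identification of the coefficients
  have hint : Integrable u volume := hu.continuous.integrable_of_hasCompactSupport (HasCompactSupport.of_compactSpace _)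
  have hcomp : ∀ (k : d → ℤ), ‖mFourierCoeff (EuclideanSpace.complexify ∘ u) k‖ ≤ ∑ i, ‖mFourierCoeff (uc i) k‖ := by
    intro k
    refine (norm_le_sum_norm_apply _).trans (le_of_eq (Finset.sum_congr rfl fun i _ => ?_))
    rw [mFourierCoeff_complexify_apply hint k i]
  -- sum the scalar tails
  have hsc : ∀ i, Summable fun k : {k // k ∉ freqBall (d := d) Q} => ‖mFourierCoeff (uc i) (k : d → ℤ)‖ :=
    fun i => (summable_norm_mFourierCoeff_scalar (huci i)).subtype _
  have hsv : Summable fun k : {k // k ∉ freqBall (d := d) Q} =>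
      ‖mFourierCoeff (EuclideanSpace.complexify ∘ u) (k : d → ℤ)‖ :=
    (summable_norm_mFourierCoeff_of_isSmooth hu).subtype _
  calc ∑' k : {k // k ∉ freqBall (d := d) Q}, ‖mFourierCoeff (EuclideanSpace.complexify ∘ u) k‖
      ≤ ∑' k : {k // k ∉ freqBall (d := d) Q}, ∑ i, ‖mFourierCoeff (uc i) (k : d → ℤ)‖ :=
        hsv.tsum_le_tsum (fun k => hcomp k) (summable_sum fun i _ => hsc i)
    _ = ∑ i, ∑' k : {k // k ∉ freqBall (d := d) Q}, ‖mFourierCoeff (uc i) (k : d → ℤ)‖ :=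
        Summable.tsum_finsetSum fun i _ => hsc i
    _ ≤ ∑ _i : d, Real.exp 1 * M * (1 + 2 * Fintype.card d * R) ^ Fintype.card d *
          Real.exp (-(Real.pi * Q / (Real.exp 1 * Fintype.card d * R))) :=
        Finset.sum_le_sum fun i _ => tsum_norm_mFourierCoeff_compl_freqBall_le (huci i) hR (hMi i) Q
    _ = _ := by rw [Finset.sum_const, Finset.card_univ, nsmul_eq_mul]

end Torus

end Literature.Analysis.FunctionSpaces

end
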